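import Literature.NumberTheory.ComplexMultiplication.CMAlgebraLatticeClassesOverorders
import HarnessLib

/-!
# The SEMIGROUP `𝓛(Y)` of full lattices of a CM-ALGEBRA `Y = L_1 ⊕ ⋯ ⊕ L_t`: products `L_1L_2`, quotients
# `L_1 : L_2`, orders `𝒪(L) = L : L`, KRULL'S LEMMA «`Λ·Λ ⊂ Λ` and `Λ·L = L` ⟹ `1_A ∈ Λ`», «the idempotents in
# `𝓛(A)` are the orders», and invertibility `L·(𝒪(L):L) = 𝒪(L)` (Hertling–Larabi 2026 §5: Lemma 5.2, Lemma 5.3,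
# Lemma 5.5, Thm. 5.6 = Dade–Taussky–Zassenhaus 1962 ∕ Faddeev 1965)

Topic `Literature/NumberTheory/ComplexMultiplication`, namespace `Literature.NumberTheory.ComplexMultiplication`;
lane `lit-hodgefound` (Track 2 foundations library), Layer A3, seat p19 generation 31, row g31-#5 — the algebra
UNDER the class sets of g31-#1…#4 (`CMAlgebraLatticeClassesFinite` / `…LatticeClasses` / `…ClassGroup` /
`…Overorders`): the full `ℤ`-lattices of `Y` (`Literature.NumberTheory.Automorphic.IsFullLattice`) form a commutative
semigroup under Mathlib's multiplication of `Submodule ℤ Y`, with Mathlib's quotient `L_1 / L_2 = {a | aL_2 ⊆ L_1}`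
(`Submodule.mem_div_iff_forall_mul_mem`) as the colon `L_1 : L_2` and `𝒪(L) = L / L` as the order of `L`; the
`ε`-classes of g31-#1 (`u • L`, `u ∈ Y^×`) are compatible with both.  THEOREMS ONLY: no definition, no instance, no
named fact (D-0026, net Literature debt `0`), no `sorry`.

## Source, VERBATIM

C. Hertling, K. Larabi, *Semigroups from full lattices in commutative ℚ-algebras*, arXiv:2602.14973 (2026)
[HertlingLarabi2026], held `paper:arxiv-2602.14973`, §5 (chunks p0011–p0012):

«**Lemma 5.2.** (a) Let `L`, `L_1` and `L_2` be full lattices in `A`. Then `L_1·L_2 := {Σ_{i∈I} a_ib_i | I` a finite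
index set, `a_i ∈ L_1, b_i ∈ L_2}` and `L_1 : L_2 := {a ∈ A | a·L_2 ⊂ L_1}` are full lattices in `A`, and `𝒪(L) := L : L`
is an order in `A`. It is called the order of `L`. (b) Let `L_1, L_2, L_3` and `L_4` be full lattices in `A`. Then
`L_1L_2 = L_2L_1`, `(L_1L_2)L_3 = L_1(L_2L_3)`, `(L_1:L_2)L_3 ⊂ (L_1L_3):L_2`, `(L_1:L_2)(L_3:L_4) ⊂ (L_1L_3):(L_2L_4)`.
(c) (Krull's lemma, [DTZ62]) Let `Λ` and `L` be full lattices in `A` with `Λ·Λ ⊂ Λ` and `Λ·L = L`. Then `1_A ∈ Λ`, so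
`Λ` is an order. […] **Lemma 5.3.** (a) If `Λ_1` and `Λ_2 ∈ 𝓛(A)` are orders, then the order `Λ_1Λ_2` contains `Λ_1`
and `Λ_2`, and it is the smallest order with this property. […] (b) Let `L_1, L_2 ∈ 𝓛(A)` with `𝒪(L_1) = Λ_1` and
`𝒪(L_2) = Λ_2`. Then `𝒪(L_1L_2) ⊃ Λ_1Λ_2`, `𝒪(L_1:L_2) ⊃ Λ_1Λ_2`. If `L_1` is invertible then `L_1:L_2 = L_1·(Λ_1:L_2)`.
If `L_2` is invertible then `L_1:L_2 = (L_1:Λ_2)·L_2⁻¹`. […] **Lemma 5.5.** The multiplication of full lattices gives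
the structure of a commutative semigroup on `𝓛(A)`. It induces the structure of a commutative semigroup on `𝓔(A)`. If
`L_1 ∼_ε L_2`, then `𝒪(L_1) = 𝒪(L_2)` […] Also the division map […] induces a division map […] on `𝓔(A)`. […]
**Theorem 5.6** (DTZ62). [Fa65] (a) `Λ ∈ 𝓛(A)` is an idempotent in the semigroup `𝓛(A)` if and only if it is an order.
(b) `[L]_ε` is an idempotent in the semigroup `𝓔(A)` if and only if the class `[L]_ε` contains an order. (c) Let
`L ∈ 𝓛(A)`. The following five properties are equivalent: (i) `L` is invertible in the semigroup `𝓛(A)`. (ii)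
`L_2 ∈ 𝓛(A)` with `L·L_2 = 𝒪(L)` exists. (iii) `L·(𝒪(L):L) = 𝒪(L)`. (iv) `[L]_ε` is invertible in the semigroup
`𝓔(A)`. (v) `𝒪(𝒪(L):L) = 𝒪(L)`. If this holds then `e_L = 𝒪(L)`, `L⁻¹ = 𝒪(L):L`, `L⁻¹` is invertible with
`𝒪(L⁻¹) = 𝒪(L)` […]» (with §1: «An element `c ∈ S` with `cc = c` is called an idempotent. An element `a ∈ S` is
called invertible if an idempotent `c` and an element `b ∈ S` with `ac = a` and `ab = c` exist.»)

## What is proved (`Y = ∏ᵢ Lᵢ` number fields; `M`, `N`, `Lⱼ`, `Λ : Submodule ℤ Y`; `IsFullLattice Y M`)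

* §0 `ε`-COMPATIBILITY (Def. 5.4 (a), Lemma 5.5): `units_smul_mul` (`u•(MN) = (u•M)N`),
  `units_smul_div_units_smul` (`(u•M)/(v•N) = (uv⁻¹)•(M/N)`), `div_self_units_smul` (`𝒪(u•M) = 𝒪(M)`),
  `isFullLattice_units_smul`.
* §1 LEMMA 5.2 (a): `isFullLattice_mul`, `isFullLattice_div` (products and quotients of full lattices are full),
  `div_self_mul_self` (`𝒪(L)L = L`), `div_self_mul_div_self_eq` (`𝒪(L)𝒪(L) = 𝒪(L)`), `one_mem_div_self`,
  `div_self_div_div_self` (`𝒪(𝒪(L)) = 𝒪(L)`), `div_self_eq_of_one_mem` (`𝒪(Λ) = Λ` for an order),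
  `forall_isIntegral_of_mem_div_self` (`𝒪(L) ⊆ 𝒪_Y`).
* §2 LEMMA 5.2 (b): `div_mul_le_mul_div` (`(L_1:L_2)L_3 ⊂ (L_1L_3):L_2`), `div_mul_div_le`
  (`(L_1:L_2)(L_3:L_4) ⊂ (L_1L_3):(L_2L_4)`) — commutativity and associativity are Mathlib's semiring structure.
* §3 KRULL'S LEMMA 5.2 (c) [DTZ62] **`one_mem_of_mul_le_of_mul_eq`**: `ΛΛ ⊆ Λ` and `ΛL = L` for a full `L` force
  `1 ∈ Λ` (Nakayama's lemma for the ideal `Λ` of the ring `ℤ·1 + Λ = Algebra.adjoin ℤ Λ` acting on the finitely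
  generated module `L`, which contains a unit); no hypothesis on `Λ` beyond `ΛΛ ⊆ Λ`.
* §4 THEOREM 5.6 (a)(b): **`mul_self_eq_iff_one_mem`** («the idempotents in `𝓛(A)` are the orders»),
  **`exists_units_smul_mul_self_eq_iff`** (the `ε`-class of `L` is idempotent iff it contains an order).
* §5 THEOREM 5.6 (c): `mul_div_div_le`, **`mul_div_div_eq_of_exists_mul_eq`** ((ii) ⟹ (iii)),
  `exists_mul_eq_div_self_iff` ((ii) ⟺ (iii)), `idempotent_eq_div_self` (`e_L = 𝒪(L)`),
  `eq_div_div_of_mul_eq_div_self` (`L⁻¹ = 𝒪(L):L`), **`exists_idempotent_iff_exists_mul_eq_div_self`** ((i) ⟺ (ii)),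
  **`exists_units_idempotent_iff`** ((iv) ⟺ (ii)), and the consequences under (iii): `div_div_self_of_mul_div_eq`
  (`𝒪(L⁻¹) = 𝒪(L)` for `L⁻¹ = 𝒪(L):L`, in particular (iii) ⟹ (v) `𝒪(𝒪(L):L) = 𝒪(L)`),
  `inv_mul_div_eq_of_mul_div_eq` (`(L⁻¹)⁻¹ ⊇ L` and `L⁻¹` is invertible: `L⁻¹·(𝒪(L):L⁻¹) = 𝒪(L) = 𝒪(L⁻¹)`).
  NOT here: (v) ⟹ (i), which the source proves through dual lattices (its Lemma 2.3).
* §6 LEMMA 5.3: `mul_isOrder_of_one_mem` (the order `Λ_1Λ_2` contains the orders `Λ_1`, `Λ_2` and is the smallest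
  multiplicatively closed lattice containing both), `div_self_mul_div_self_le_div_self_mul`
  (`𝒪(L_1)𝒪(L_2) ⊆ 𝒪(L_1L_2)`), `div_self_mul_div_self_le_div_self_div` (`𝒪(L_1)𝒪(L_2) ⊆ 𝒪(L_1:L_2)`),
  **`div_eq_mul_div_of_mul_div_eq`** (`L_1` invertible ⟹ `L_1:L_2 = L_1·(𝒪(L_1):L_2)`),
  **`div_eq_div_mul_of_mul_div_eq`** (`L_2` invertible ⟹ `L_1:L_2 = (L_1:𝒪(L_2))·L_2⁻¹`).

## References
* [HertlingLarabi2026] C. Hertling, K. Larabi, arXiv:2602.14973 (2026), §5 Lemma 5.2, Lemma 5.3, Def. 5.4,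
  Lemma 5.5, Thm. 5.6 (chunks p0011–p0012); §1 (chunk p0003). [cite: HertlingLarabi2026, §5 Thm. 5.6, chunk p0012]
* [DadeTausskyZassenhaus1962] E. C. Dade, O. Taussky, H. Zassenhaus, *On the theory of orders …*, Math. Ann. 148
  (1962) 31–64 (Krull's lemma; idempotents and invertible elements of the semigroup of lattices; cited as [DTZ62]).
  [cite: DadeTausskyZassenhaus1962, §1 (Krull's lemma; Thm. 5.6 of HertlingLarabi2026 is attributed to it)]
* [Marseglia2019] S. Marseglia, J. LMS 101 (2020), §2 (ideal quotient `(I:J)`, multiplicator ring, invertible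
  ideals `I(R:I) = R`). [cite: Marseglia2019, §2, p. 4]
-/

noncomputable section

open scoped Classical Pointwise nonZeroDivisors NumberField
open Module NumberField Function

namespace Literature.NumberTheory.ComplexMultiplication

open Literature.NumberTheory.Automorphic

section Semigroup

variable {t : Type} {L : t → Type} [∀ i, Field (L i)] [∀ i, NumberField (L i)] [Fintype t]

/-! ## §0 Units act compatibly with products and quotients (Lemma 5.5) -/

omit [∀ i, NumberField (L i)] [Fintype t] in
/-- `(u•m)n = u•(mn)` (file-local bookkeeping for the unit action). [folklore] -/
private theorem units_smul_mul_eq (u : (Π i, L i)ˣ) (m n : Π i, L i) : u • m * n = u • (m * n) := by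
  rw [Units.smul_def, Units.smul_def, smul_eq_mul, smul_eq_mul, mul_assoc]

omit [∀ i, NumberField (L i)] [Fintype t] in
/-- **`u•(MN) = (u•M)N`** — the `ε`-classes are compatible with the product: «`a_1a_2L_1L_2 = L_3L_4` … so
`L_1L_2 ∼_ε L_3L_4`». [cite: HertlingLarabi2026, §5 Lemma 5.5 (proof), chunk p0012] -/
theorem units_smul_mul (u : (Π i, L i)ˣ) (M N : Submodule ℤ (Π i, L i)) : u • (M * N) = (u • M) * N := by
  refine le_antisymm (fun x hx => ?_) (Submodule.mul_le.2 fun m hm n hn => ?_)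
  · rw [mem_units_smul_submodule_iff] at hx
    rw [← smul_inv_smul u x]
    refine Submodule.mul_induction_on hx (fun m hm n hn => ?_) (fun a b ha hb => ?_)
    · rw [← units_smul_mul_eq]
      exact Submodule.mul_mem_mul (Submodule.smul_mem_pointwise_smul _ _ _ hm) hn
    · rw [smul_add]
      exact Submodule.add_mem _ ha hb
  · rw [mem_units_smul_submodule_iff] at hm ⊢
    rw [← units_smul_mul_eq]
    exact Submodule.mul_mem_mul hm hn

omit [∀ i, NumberField (L i)] [Fintype t] in
/-- `u•(PQ) = P(u•Q)` (file-local). [folklore] -/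
private theorem units_smul_mul_right (u : (Π i, L i)ˣ) (P Q : Submodule ℤ (Π i, L i)) :
    u • (P * Q) = P * (u • Q) := by
  rw [mul_comm P (u • Q), ← units_smul_mul, mul_comm]

omit [∀ i, NumberField (L i)] [Fintype t] in
/-- **`(u•M)/(v•N) = (uv⁻¹)•(M/N)`** — the `ε`-classes are compatible with the quotient: «`(a_1a_2⁻¹)·(L_1:L_2) = L_3:L_4`».
[cite: HertlingLarabi2026, §5 Lemma 5.5 (proof), chunk p0012] -/
theorem units_smul_div_units_smul (u v : (Π i, L i)ˣ) (M N : Submodule ℤ (Π i, L i)) :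
    (u • M) / (v • N) = (u * v⁻¹) • (M / N) := by
  ext x
  rw [Submodule.mem_div_iff_forall_mul_mem, mem_units_smul_submodule_iff, Submodule.mem_div_iff_forall_mul_mem]
  constructor
  · intro h y hy
    have h1 := h (v • y) (Submodule.smul_mem_pointwise_smul _ _ _ hy)
    rw [mem_units_smul_submodule_iff] at h1
    have h2 : (u⁻¹ : (Π i, L i)ˣ) • (x * v • y) = (u * v⁻¹)⁻¹ • x * y := by
      rw [mul_inv_rev, inv_inv, Units.smul_def, Units.smul_def, Units.smul_def, smul_eq_mul, smul_eq_mul, smul_eq_mul,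
        Units.val_mul]
      ring
    rwa [h2] at h1
  · intro h y hy
    rw [mem_units_smul_submodule_iff] at hy ⊢
    have h1 := h _ hy
    have h2 : (u * v⁻¹)⁻¹ • x * (v⁻¹ : (Π i, L i)ˣ) • y = (u⁻¹ : (Π i, L i)ˣ) • (x * y) := by
      rw [mul_inv_rev, inv_inv, Units.smul_def, Units.smul_def, Units.smul_def, smul_eq_mul, smul_eq_mul, smul_eq_mul,
        Units.val_mul]
      calc (v : Π i, L i) * ↑u⁻¹ * x * (↑v⁻¹ * y) = (v : Π i, L i) * ↑v⁻¹ * (↑u⁻¹ * (x * y)) := by ring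
        _ = ↑u⁻¹ * (x * y) := by rw [Units.mul_inv, one_mul]
    rwa [h2] at h1

omit [∀ i, NumberField (L i)] [Fintype t] in
/-- **`𝒪(u•M) = 𝒪(M)`**: «If `L_1 ∼_ε L_2`, then `𝒪(L_1) = 𝒪(L_2)`». [cite: HertlingLarabi2026, §5 Lemma 5.5, chunk p0012] -/
theorem div_self_units_smul (u : (Π i, L i)ˣ) (M : Submodule ℤ (Π i, L i)) : (u • M) / (u • M) = M / M := by
  rw [units_smul_div_units_smul, mul_inv_cancel, one_smul]

omit [∀ i, NumberField (L i)] [Fintype t] in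
/-- **`a·L` is a full lattice for a full lattice `L` and a unit `a`** (the `ε`-class `[L]_ε = {aL | a ∈ A^{unit}}`
consists of full lattices). [cite: HertlingLarabi2026, §5 Def. 5.4 (a), chunk p0011] -/
theorem isFullLattice_units_smul (u : (Π i, L i)ˣ) {M : Submodule ℤ (Π i, L i)}
    (hM : IsFullLattice (Π i, L i) M) : IsFullLattice (Π i, L i) (u • M) := by
  refine ⟨?_, fun d => ?_⟩
  · rw [Units.smul_def]
    exact hM.1.map _
  · obtain ⟨n, hn, hnd⟩ := hM.2 ((u⁻¹ : (Π i, L i)ˣ) • d)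
    refine ⟨n, hn, mem_units_smul_submodule_iff.2 ?_⟩
    rwa [smul_comm]

/-! ## §1 Lemma 5.2 (a): products, quotients and orders of full lattices are full lattices -/

omit [Fintype t] in
/-- A full lattice contains `k·1` for an integer `k ≠ 0`, a unit of `Y` (file-local). [cite: HertlingLarabi2026, §5 Lemma 5.2 (proof of (a): «it contains a unit»), chunk p0011] -/
private theorem exists_isUnit_zsmul_one_mem {M : Submodule ℤ (Π i, L i)} (hM : IsFullLattice (Π i, L i) M) :
    ∃ k : ℤ, k ≠ 0 ∧ (k • (1 : Π i, L i)) ∈ M ∧ IsUnit (k • (1 : Π i, L i)) := by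
  obtain ⟨k, hk, hk1⟩ := hM.2 1
  refine ⟨k, hk, hk1, ?_⟩
  rw [zsmul_eq_mul, mul_one, ← map_intCast (algebraMap ℚ (Π i, L i)) k]
  exact (((Int.cast_ne_zero (α := ℚ)).2 hk).isUnit).map _

omit [Fintype t] in
/-- **`L_1L_2` is a full lattice** («As `L_1·L_2` is a finitely generated **Z**-module, it is a full lattice»: it is
finitely generated and `(nd)(k·1) ∈ L_1L_2`). [cite: HertlingLarabi2026, §5 Lemma 5.2 (a), chunk p0011] -/
theorem isFullLattice_mul {M N : Submodule ℤ (Π i, L i)} (hM : IsFullLattice (Π i, L i) M)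
    (hN : IsFullLattice (Π i, L i) N) : IsFullLattice (Π i, L i) (M * N) := by
  refine ⟨hM.1.mul hN.1, fun d => ?_⟩
  obtain ⟨n, hn, hnd⟩ := hM.2 d
  obtain ⟨k, hk, hk1, -⟩ := exists_isUnit_zsmul_one_mem hN
  refine ⟨n * k, mul_ne_zero hn hk, ?_⟩
  have h1 : (n * k) • d = (n • d) * (k • (1 : Π i, L i)) := by
    rw [zsmul_eq_mul, zsmul_eq_mul, zsmul_eq_mul, mul_one, Int.cast_mul]
    ring
  rw [h1]
  exact Submodule.mul_mem_mul hnd hk1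

omit [Fintype t] in
/-- **`L_1 : L_2` is a full lattice**: it lies in `(k·1)⁻¹L_1` for `k·1 ∈ L_2` (finitely generated over the Noetherian
`ℤ`), and `n·d ∈ L_1:L_2` as soon as `n(dL_2) ⊆ L_1` (`dL_2` is finitely generated, `L_1` is full).
[cite: HertlingLarabi2026, §5 Lemma 5.2 (a) (via Lemma 2.3 (a)), chunk p0011] [cite: Marseglia2019, §2 (the ideal quotient `(I:J)` is a fractional ideal), p. 4] -/
theorem isFullLattice_div {M N : Submodule ℤ (Π i, L i)} (hM : IsFullLattice (Π i, L i) M)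
    (hN : IsFullLattice (Π i, L i) N) : IsFullLattice (Π i, L i) (M / N) := by
  refine ⟨?_, fun d => ?_⟩
  · obtain ⟨k, -, hk1, hku⟩ := exists_isUnit_zsmul_one_mem hN
    have hle : M / N ≤ hku.unit⁻¹ • M := fun a ha => by
      rw [mem_units_smul_submodule_iff, inv_inv, Units.smul_def, IsUnit.unit_spec, smul_eq_mul, mul_comm]
      exact (Submodule.mem_div_iff_forall_mul_mem.1 ha) _ hk1
    refine Submodule.FG.of_le ?_ hle
    rw [Units.smul_def]
    exact hM.1.map _
  · have hdN : (d • N).FG := hN.1.map _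
    obtain ⟨n, hn, hnM⟩ := exists_smul_mem_of_fg hM hdN
    refine ⟨n, hn, Submodule.mem_div_iff_forall_mul_mem.2 fun y hy => ?_⟩
    rw [smul_mul_assoc]
    exact hnM _ (Submodule.smul_mem_pointwise_smul y d N hy)

omit [∀ i, NumberField (L i)] [Fintype t] in
/-- `1 ∈ 𝒪(L) = L : L`. [cite: HertlingLarabi2026, §5 Lemma 5.2 (a) («Obviously, it contains `1_A`»), chunk p0011] -/
theorem one_mem_div_self (M : Submodule ℤ (Π i, L i)) : (1 : Π i, L i) ∈ M / M :=
  Submodule.one_mem_div.2 le_rfl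

omit [∀ i, NumberField (L i)] [Fintype t] in
/-- **`𝒪(L)·L = L`**. [cite: HertlingLarabi2026, §5 (proof of Thm. 5.6 (c): «`𝒪(L)L = L`»), chunk p0012] -/
theorem div_self_mul_self (M : Submodule ℤ (Π i, L i)) : (M / M) * M = M := by
  refine le_antisymm (Submodule.le_div_iff_mul_le.1 le_rfl) fun x hx => ?_
  rw [← one_mul x]
  exact Submodule.mul_mem_mul (one_mem_div_self M) hx

omit [∀ i, NumberField (L i)] [Fintype t] in
/-- **`𝒪(L)𝒪(L) = 𝒪(L)`** — an order is an idempotent («Because of `1 ∈ Λ`, we have `ΛΛ = Λ`»); with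
`one_mem_div_self`: «`𝒪(L)` … is an order» (multiplication invariant, contains `1`).
[cite: HertlingLarabi2026, §5 Lemma 5.2 (a) and Thm. 5.6 (a) (proof, «⟸»), chunks p0011–p0012] -/
theorem div_self_mul_div_self_eq (M : Submodule ℤ (Π i, L i)) : (M / M) * (M / M) = M / M := by
  refine le_antisymm (Submodule.mul_le.2 fun a ha b hb => ?_) fun x hx => ?_
  · rw [Submodule.mem_div_iff_forall_mul_mem] at ha hb ⊢
    intro y hy
    rw [mul_assoc]
    exact ha _ (hb y hy)
  · rw [← one_mul x]
    exact Submodule.mul_mem_mul (one_mem_div_self M) hx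

omit [∀ i, NumberField (L i)] [Fintype t] in
/-- **`𝒪(𝒪(L)) = 𝒪(L)`**: the order of an order `Λ` (`1 ∈ Λ`, `ΛΛ ⊆ Λ`) is `Λ` itself, here for `Λ = 𝒪(L)`.
[cite: HertlingLarabi2026, §1 Lemma 1.2 (a) («The idempotents in `𝓛(A)` are the orders»), chunk p0003; §5 Lemma 5.2 (a), chunk p0011] -/
theorem div_self_div_div_self (M : Submodule ℤ (Π i, L i)) : (M / M) / (M / M) = M / M := by
  refine le_antisymm (fun x hx => ?_) (Submodule.le_div_iff_mul_le.2 (div_self_mul_div_self_eq M).le)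
  have h1 := (Submodule.mem_div_iff_forall_mul_mem.1 hx) 1 (one_mem_div_self M)
  rwa [mul_one] at h1

omit [∀ i, NumberField (L i)] [Fintype t] in
/-- An order is its own order: `1 ∈ Λ`, `ΛΛ ⊆ Λ ⟹ Λ/Λ = Λ`. [cite: HertlingLarabi2026, §1 Lemma 1.2 (a), chunk p0003] -/
theorem div_self_eq_of_one_mem {Λ : Submodule ℤ (Π i, L i)} (h1 : (1 : Π i, L i) ∈ Λ) (hmul : Λ * Λ ≤ Λ) :
    Λ / Λ = Λ := by
  refine le_antisymm (fun x hx => ?_) (Submodule.le_div_iff_mul_le.2 hmul)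
  have h2 := (Submodule.mem_div_iff_forall_mul_mem.1 hx) 1 h1
  rwa [mul_one] at h2

omit [Fintype t] in
/-- **`𝒪(L) ⊆ 𝒪_Y`: the order of a full lattice consists of algebraic integers** (g31-#4
`isIntegral_of_forall_mul_mem`, rephrased for `L / L`). [cite: HertlingLarabi2026, §6 Cor. 6.2 (a), chunk p0015; §5 Lemma 5.2 (a), chunk p0011] -/
theorem forall_isIntegral_of_mem_div_self {M : Submodule ℤ (Π i, L i)} (hM : IsFullLattice (Π i, L i) M)
    {a : Π i, L i} (ha : a ∈ M / M) : IsIntegral ℤ a :=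
  isIntegral_of_forall_mul_mem hM fun m hm => by
    rw [mul_comm]
    exact (Submodule.mem_div_iff_forall_mul_mem.1 ha) m hm

/-! ## §2 Lemma 5.2 (b): the two inclusions -/

omit [∀ i, NumberField (L i)] [Fintype t] in
/-- **`(L_1:L_2)L_3 ⊆ (L_1L_3):L_2`**. [cite: HertlingLarabi2026, §5 Lemma 5.2 (b) (5.2), chunk p0011] -/
theorem div_mul_le_mul_div (L₁ L₂ L₃ : Submodule ℤ (Π i, L i)) : (L₁ / L₂) * L₃ ≤ (L₁ * L₃) / L₂ := by
  refine Submodule.mul_le.2 fun a ha c hc => Submodule.mem_div_iff_forall_mul_mem.2 fun y hy => ?_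
  rw [mul_right_comm]
  exact Submodule.mul_mem_mul ((Submodule.mem_div_iff_forall_mul_mem.1 ha) y hy) hc

omit [∀ i, NumberField (L i)] [Fintype t] in
/-- **`(L_1:L_2)(L_3:L_4) ⊆ (L_1L_3):(L_2L_4)`**. [cite: HertlingLarabi2026, §5 Lemma 5.2 (b) (5.2), chunk p0011] -/
theorem div_mul_div_le (L₁ L₂ L₃ L₄ : Submodule ℤ (Π i, L i)) :
    (L₁ / L₂) * (L₃ / L₄) ≤ (L₁ * L₃) / (L₂ * L₄) := by
  refine Submodule.mul_le.2 fun a ha c hc => Submodule.mem_div_iff_forall_mul_mem.2 fun y hy => ?_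
  refine Submodule.mul_induction_on hy (fun b hb d hd => ?_) (fun y₁ y₂ h₁ h₂ => ?_)
  · rw [mul_mul_mul_comm]
    exact Submodule.mul_mem_mul ((Submodule.mem_div_iff_forall_mul_mem.1 ha) b hb)
      ((Submodule.mem_div_iff_forall_mul_mem.1 hc) d hd)
  · rw [mul_add]
    exact Submodule.add_mem _ h₁ h₂

/-! ## §3 Krull's lemma (Lemma 5.2 (c), [DTZ62]) -/

omit [Fintype t] in
/-- **KRULL'S LEMMA [DTZ62]: `Λ·Λ ⊆ Λ` and `Λ·L = L` for a full lattice `L` imply `1 ∈ Λ`** («so `Λ` is an order»).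
The source argues with a `ℤ`-basis of `L` and `det(δ_{ij} − a_{ij}) = 0`; here the same determinant trick is
Nakayama's lemma for the ideal `Λ` of the commutative ring `ℤ·1 + Λ = Algebra.adjoin ℤ Λ ⊆ Y` and its finitely
generated module `L = ΛL`: some `r ≡ 1 (mod Λ)` kills `L`, and `L` contains a unit, so `r = 0` and `1 ∈ Λ`.
[cite: HertlingLarabi2026, §5 Lemma 5.2 (c) (Krull's lemma), chunk p0011] [cite: DadeTausskyZassenhaus1962, §1 (Krull's lemma, as cited)] -/
theorem one_mem_of_mul_le_of_mul_eq {Λ M : Submodule ℤ (Π i, L i)} (hΛ : Λ * Λ ≤ Λ)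
    (hM : IsFullLattice (Π i, L i) M) (hΛM : Λ * M = M) : (1 : Π i, L i) ∈ Λ := by
  -- the ring `R = ℤ·1 + Λ` and its ideal `Λ`
  let S : Subalgebra ℤ (Π i, L i) := Algebra.adjoin ℤ (Λ : Set (Π i, L i))
  haveI : IsScalarTower S S (Π i, L i) := IsScalarTower.left _
  have hstab : ∀ r ∈ S, (∀ a ∈ Λ, r * a ∈ Λ) ∧ ∀ m ∈ M, r * m ∈ M := by
    intro r hr
    refine Algebra.adjoin_induction (fun x hx => ⟨fun a ha => hΛ (Submodule.mul_mem_mul hx ha), fun m hm => ?_⟩)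
      (fun k => ⟨fun a ha => ?_, fun m hm => ?_⟩) (fun x y _ _ hx hy => ⟨fun a ha => ?_, fun m hm => ?_⟩)
      (fun x y _ _ hx hy => ⟨fun a ha => ?_, fun m hm => ?_⟩) hr
    · rw [← hΛM]
      exact Submodule.mul_mem_mul hx hm
    · rw [Algebra.algebraMap_eq_smul_one, smul_mul_assoc, one_mul]
      exact Λ.smul_mem k ha
    · rw [Algebra.algebraMap_eq_smul_one, smul_mul_assoc, one_mul]
      exact M.smul_mem k hm
    · rw [add_mul]; exact Λ.add_mem (hx.1 a ha) (hy.1 a ha)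
    · rw [add_mul]; exact M.add_mem (hx.2 m hm) (hy.2 m hm)
    · rw [mul_assoc]; exact hx.1 _ (hy.1 a ha)
    · rw [mul_assoc]; exact hx.2 _ (hy.2 m hm)
  let I : Ideal S :=
    { carrier := {r | (r : Π i, L i) ∈ Λ}
      add_mem' := fun {a b} ha hb => by
        change ((a : Π i, L i) + b) ∈ Λ
        exact Λ.add_mem ha hb
      zero_mem' := Λ.zero_mem
      smul_mem' := fun r a ha => by
        change ((r : Π i, L i) * a) ∈ Λ
        exact (hstab r r.2).1 _ ha }
  let N : Submodule S (Π i, L i) :=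
    { carrier := M
      add_mem' := fun ha hb => M.add_mem ha hb
      zero_mem' := M.zero_mem
      smul_mem' := fun r m hm => by
        change ((r : Π i, L i) * m) ∈ M
        exact (hstab r r.2).2 m hm }
  -- `N` is finitely generated over `S` (the `ℤ`-generators of `M` generate) and `N ≤ I • N` (`M = ΛM`)
  have hNfg : N.FG := by
    obtain ⟨s, hs⟩ := hM.1
    refine ⟨s, le_antisymm (Submodule.span_le.2 fun x hx => ?_) fun x hx => ?_⟩
    · change x ∈ M
      rw [← hs]
      exact Submodule.subset_span hx
    · have hx' : x ∈ Submodule.span ℤ (s : Set (Π i, L i)) := by rw [hs]; exact hx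
      exact Submodule.span_le_restrictScalars ℤ S (s : Set (Π i, L i)) hx'
  have hIN : N ≤ I • N := by
    intro x hx
    have hx' : x ∈ Λ * M := by rw [hΛM]; exact hx
    refine Submodule.mul_induction_on hx' (fun a ha m hm => ?_) (fun x y hx hy => Submodule.add_mem _ hx hy)
    exact Submodule.smul_mem_smul (r := (⟨a, Algebra.subset_adjoin ha⟩ : S)) (n := m) ha hm
  obtain ⟨r, hr1, hr0⟩ := Submodule.exists_sub_one_mem_and_smul_eq_zero_of_fg_of_le_smul I N hNfg hIN
  -- `r` kills the unit `k·1 ∈ M`, so `r = 0` and `1 = -(r - 1) ∈ Λ`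
  obtain ⟨k, -, hk1, hku⟩ := exists_isUnit_zsmul_one_mem hM
  have hr : (r : Π i, L i) = 0 := by
    have h0 : (r : Π i, L i) * (k • (1 : Π i, L i)) = 0 := hr0 _ hk1
    exact (hku.mul_left_eq_zero).1 h0
  have h1 : ((r : Π i, L i) - 1) ∈ Λ := hr1
  rw [hr, zero_sub] at h1
  simpa using Λ.neg_mem h1

/-! ## §4 Theorem 5.6 (a)(b): the idempotents of `𝓛(Y)` are the orders -/

omit [Fintype t] in
/-- **THEOREM 5.6 (a) [DTZ62 ∕ Fa65]: a full lattice `Λ` is an idempotent of `𝓛(Y)` (`ΛΛ = Λ`) iff it is an ORDER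
(`1 ∈ Λ` and `ΛΛ ⊆ Λ`)** — «⟹» is Krull's lemma with `L = Λ`. [cite: HertlingLarabi2026, §5 Thm. 5.6 (a), chunk p0012] [cite: DadeTausskyZassenhaus1962, §1] -/
theorem mul_self_eq_iff_one_mem {Λ : Submodule ℤ (Π i, L i)} (hΛ : IsFullLattice (Π i, L i) Λ) :
    Λ * Λ = Λ ↔ (1 : Π i, L i) ∈ Λ ∧ Λ * Λ ≤ Λ := by
  refine ⟨fun h => ⟨one_mem_of_mul_le_of_mul_eq h.le hΛ h, h.le⟩, fun ⟨h1, hmul⟩ => le_antisymm hmul fun x hx => ?_⟩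
  rw [← one_mul x]
  exact Submodule.mul_mem_mul h1 hx

omit [Fintype t] in
/-- **THEOREM 5.6 (b): the `ε`-class of a full lattice `L` is an idempotent of `𝓔(Y)` (`u•(LL) = L` for a unit `u`) iff
the class contains an ORDER (`1 ∈ u•L`, `(u•L)(u•L) ⊆ u•L` for a unit `u`)** («Then `(aL)² = aL`, and `aL ∈ [L]_ε` is
an idempotent in `𝓛(A)`. By part (a), `aL` is an order»). [cite: HertlingLarabi2026, §5 Thm. 5.6 (b), chunk p0012] [cite: DadeTausskyZassenhaus1962, §1] -/
theorem exists_units_smul_mul_self_eq_iff {M : Submodule ℤ (Π i, L i)} (hM : IsFullLattice (Π i, L i) M) :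
    (∃ u : (Π i, L i)ˣ, u • (M * M) = M) ↔
      ∃ u : (Π i, L i)ˣ, (1 : Π i, L i) ∈ u • M ∧ (u • M) * (u • M) ≤ u • M := by
  have hfull : ∀ u : (Π i, L i)ˣ, IsFullLattice (Π i, L i) (u • M) := fun u => isFullLattice_units_smul u hM
  have hsq : ∀ u : (Π i, L i)ˣ, (u • M) * (u • M) = u • (u • (M * M)) := fun u => by
    rw [units_smul_mul, mul_comm (u • M) M, ← units_smul_mul, mul_comm]
  constructor
  · rintro ⟨u, hu⟩
    have hid : (u • M) * (u • M) = u • M := by rw [hsq, hu]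
    exact ⟨u, ((mul_self_eq_iff_one_mem (hfull u)).1 hid)⟩
  · rintro ⟨u, h1, hmul⟩
    have hid : (u • M) * (u • M) = u • M := (mul_self_eq_iff_one_mem (hfull u)).2 ⟨h1, hmul⟩
    refine ⟨u, ?_⟩
    rw [hsq] at hid
    exact MulAction.injective u hid

/-! ## §5 Theorem 5.6 (c): invertibility -/

omit [∀ i, NumberField (L i)] [Fintype t] in
/-- `L·(𝒪(L):L) ⊆ 𝒪(L)` always. [cite: HertlingLarabi2026, §5 Thm. 5.6 (c) (proof of (ii) ⟹ (iii)), chunk p0012] -/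
theorem mul_div_div_le (M : Submodule ℤ (Π i, L i)) : M * ((M / M) / M) ≤ M / M := by
  rw [mul_comm]
  exact Submodule.le_div_iff_mul_le.1 le_rfl

omit [∀ i, NumberField (L i)] [Fintype t] in
/-- **THEOREM 5.6 (c) (ii) ⟹ (iii): if `L·L_2 = 𝒪(L)` for some lattice `L_2` then `L·(𝒪(L):L) = 𝒪(L)`** («By
definition of `𝒪(L):L`, `L_2 ⊂ 𝒪(L):L` and `L·(𝒪(L):L) ⊂ 𝒪(L)`»). [cite: HertlingLarabi2026, §5 Thm. 5.6 (c) (ii) ⟹ (iii), chunk p0012]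
[cite: Marseglia2019, §2 (invertible ideals: `I(R:I) = R`), p. 4] -/
theorem mul_div_div_eq_of_exists_mul_eq {M : Submodule ℤ (Π i, L i)}
    (h : ∃ L₂ : Submodule ℤ (Π i, L i), M * L₂ = M / M) : M * ((M / M) / M) = M / M := by
  obtain ⟨L₂, hL₂⟩ := h
  refine le_antisymm (mul_div_div_le M) ?_
  have hle : L₂ ≤ (M / M) / M := Submodule.le_div_iff_mul_le.2 (by rw [mul_comm, hL₂])
  calc M / M = M * L₂ := hL₂.symm
    _ ≤ M * ((M / M) / M) := mul_le_mul_right hle _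

omit [Fintype t] in
/-- **THEOREM 5.6 (c) (ii) ⟺ (iii)** (for (iii) ⟹ (ii) take `L_2 = 𝒪(L):L`, a full lattice by §1).
[cite: HertlingLarabi2026, §5 Thm. 5.6 (c), chunk p0012] -/
theorem exists_mul_eq_div_self_iff {M : Submodule ℤ (Π i, L i)} (hM : IsFullLattice (Π i, L i) M) :
    (∃ L₂ : Submodule ℤ (Π i, L i), IsFullLattice (Π i, L i) L₂ ∧ M * L₂ = M / M) ↔ M * ((M / M) / M) = M / M :=
  ⟨fun ⟨L₂, _, hL₂⟩ => mul_div_div_eq_of_exists_mul_eq ⟨L₂, hL₂⟩,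
    fun h => ⟨(M / M) / M, isFullLattice_div (isFullLattice_div hM hM) hM, h⟩⟩

omit [Fintype t] in
/-- **`e_L = 𝒪(L)`: an idempotent `E` of `𝓛(Y)` with `LE = L` and `LL_2 = E` is the order `𝒪(L)`** («The last
condition says `Λ ⊂ 𝒪(L)`. Now `LL_2 = 𝒪(L)LL_2 = 𝒪(L)Λ = 𝒪(L)`»). [cite: HertlingLarabi2026, §5 Thm. 5.6 (c) («then `e_L = 𝒪(L)`»; proof of (i) ⟹ (ii)), chunk p0012] -/
theorem idempotent_eq_div_self {M E L₂ : Submodule ℤ (Π i, L i)} (hE : IsFullLattice (Π i, L i) E)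
    (hEE : E * E = E) (hME : M * E = M) (hML₂ : M * L₂ = E) : E = M / M := by
  have h1E : (1 : Π i, L i) ∈ E := ((mul_self_eq_iff_one_mem hE).1 hEE).1
  -- `E ⊆ 𝒪(L)` and `𝒪(L)E = 𝒪(L)`
  have hEO : E ≤ M / M := Submodule.le_div_iff_mul_le.2 (by rw [mul_comm, hME])
  have hOE : (M / M) * E = M / M := by
    refine le_antisymm ?_ fun x hx => ?_
    · calc (M / M) * E ≤ (M / M) * (M / M) := mul_le_mul_right hEO _
        _ = M / M := div_self_mul_div_self_eq M
    · rw [← mul_one x]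
      exact Submodule.mul_mem_mul hx h1E
  calc E = M * L₂ := hML₂.symm
    _ = ((M / M) * M) * L₂ := by rw [div_self_mul_self]
    _ = (M / M) * (M * L₂) := mul_assoc _ _ _
    _ = M / M := by rw [hML₂, hOE]

omit [∀ i, NumberField (L i)] [Fintype t] in
/-- **`L⁻¹ = 𝒪(L):L`: the inverse of `L` in the group of the idempotent `𝒪(L)` — `LL_2 = 𝒪(L)`, `𝒪(L)L_2 = L_2` — is
`𝒪(L):L`.** [cite: HertlingLarabi2026, §5 Thm. 5.6 (c) («`L⁻¹ = 𝒪(L):L`»), chunk p0012] [cite: Marseglia2019, §2, p. 4] -/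
theorem eq_div_div_of_mul_eq_div_self {M L₂ : Submodule ℤ (Π i, L i)} (hML₂ : M * L₂ = M / M)
    (hOL₂ : (M / M) * L₂ = L₂) : L₂ = (M / M) / M := by
  refine le_antisymm (Submodule.le_div_iff_mul_le.2 (by rw [mul_comm, hML₂])) fun x hx => ?_
  rw [Submodule.mem_div_iff_forall_mul_mem] at hx
  have h1 : (1 : Π i, L i) ∈ M * L₂ := by rw [hML₂]; exact one_mem_div_self M
  have key : ∀ w ∈ M * L₂, x * w ∈ L₂ := fun w hw =>
    Submodule.mul_induction_on hw (fun m hm l hl => by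
        rw [← mul_assoc]
        exact hOL₂.le (Submodule.mul_mem_mul (hx m hm) hl))
      (fun y z hy hz => by rw [mul_add]; exact L₂.add_mem hy hz)
  simpa using key 1 h1

omit [Fintype t] in
/-- **THEOREM 5.6 (c) (i) ⟺ (ii): `L` is invertible in the semigroup `𝓛(Y)` — an idempotent `E` (`EE = E`) and an
`L_2` with `LE = L`, `LL_2 = E` exist — iff `L·L_2 = 𝒪(L)` for some `L_2`**; and then `E = 𝒪(L)` («The last condition
says `Λ ⊂ 𝒪(L)`. Now `LL_2 = 𝒪(L)LL_2 = 𝒪(L)Λ = 𝒪(L)`»). [cite: HertlingLarabi2026, §5 Thm. 5.6 (c) (i) ⟺ (ii) and §1 («invertible»), chunks p0012, p0003]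
[cite: DadeTausskyZassenhaus1962, §1] -/
theorem exists_idempotent_iff_exists_mul_eq_div_self {M : Submodule ℤ (Π i, L i)}
    (hM : IsFullLattice (Π i, L i) M) :
    (∃ E L₂ : Submodule ℤ (Π i, L i), IsFullLattice (Π i, L i) E ∧ IsFullLattice (Π i, L i) L₂ ∧
        E * E = E ∧ M * E = M ∧ M * L₂ = E) ↔
      ∃ L₂ : Submodule ℤ (Π i, L i), IsFullLattice (Π i, L i) L₂ ∧ M * L₂ = M / M := by
  constructor
  · rintro ⟨E, L₂, hE, hL₂, hEE, hME, hML₂⟩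
    exact ⟨L₂, hL₂, hML₂.trans (idempotent_eq_div_self hE hEE hME hML₂)⟩
  · rintro ⟨L₂, hL₂, hML₂⟩
    exact ⟨M / M, L₂, isFullLattice_div hM hM, hL₂, div_self_mul_div_self_eq M,
      by rw [mul_comm, div_self_mul_self], hML₂⟩

omit [Fintype t] in
/-- **THEOREM 5.6 (c) (iv) ⟺ (ii): the `ε`-class `[L]` is invertible in `𝓔(Y)` — classes `[E]`, `[L_1]` with `[E][E] = [E]`,
`[L][E] = [L]`, `[L][L_1] = [E]` (products up to units) — iff `L·L_2 = 𝒪(L)` for some `L_2`** («Thus `a ∈ A^{unit}` with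
`aLL_1 = Λ` exists, so `Λ ⊃ 𝒪(L)`. Now `[L]_ε = [LΛ]_ε` shows `Λ = 𝒪(L)`»). [cite: HertlingLarabi2026, §5 Thm. 5.6 (c) (iii) ⟹ (iv) ⟹ (i), chunk p0012] -/
theorem exists_units_idempotent_iff {M : Submodule ℤ (Π i, L i)} (hM : IsFullLattice (Π i, L i) M) :
    (∃ (E L₁ : Submodule ℤ (Π i, L i)) (u₁ u₂ u₃ : (Π i, L i)ˣ), IsFullLattice (Π i, L i) E ∧
        IsFullLattice (Π i, L i) L₁ ∧ u₁ • (E * E) = E ∧ u₂ • (M * E) = M ∧ u₃ • (M * L₁) = E) ↔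
      ∃ L₂ : Submodule ℤ (Π i, L i), IsFullLattice (Π i, L i) L₂ ∧ M * L₂ = M / M := by
  constructor
  · rintro ⟨E, L₁, u₁, u₂, u₃, hE, hL₁, hEE, hME, hML₁⟩
    -- the order `Λ = a • E` in the class of `E`
    obtain ⟨a, h1Λ, hΛΛ⟩ := (exists_units_smul_mul_self_eq_iff hE).1 ⟨u₁, hEE⟩
    have hΛ : IsFullLattice (Π i, L i) (a • E) := isFullLattice_units_smul a hE
    have hΛid : (a • E) * (a • E) = a • E := (mul_self_eq_iff_one_mem hΛ).2 ⟨h1Λ, hΛΛ⟩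
    have hΛord : (a • E) / (a • E) = a • E := div_self_eq_of_one_mem h1Λ hΛΛ
    -- `(a u₃) • (M L₁) = Λ`, hence `𝒪(L) ⊆ Λ`
    have hMΛ : (a * u₃) • (M * L₁) = a • E := by rw [mul_smul, hML₁]
    have hOle : M / M ≤ a • E := by
      have h2 : (M / M) * (a • E) = a • E := by
        rw [← hMΛ, ← units_smul_mul_right, ← mul_assoc, div_self_mul_self]
      rw [← hΛord]
      exact Submodule.le_div_iff_mul_le.2 h2.le
    -- `Λ ⊆ 𝒪(LΛ) = 𝒪(u • (M E)) = 𝒪(M)`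
    have hΛle : a • E ≤ M / M := by
      have h3 : a • E ≤ (M * (a • E)) / (M * (a • E)) :=
        Submodule.le_div_iff_mul_le.2 (by rw [mul_left_comm, hΛid])
      have h4 : (M * (a • E)) / (M * (a • E)) = M / M := by
        have e1 : M * (a • E) = a • (M * E) := by rw [mul_comm M (a • E), ← units_smul_mul, mul_comm E M]
        rw [e1, div_self_units_smul]
        conv_rhs => rw [← hME, div_self_units_smul]
      rwa [h4] at h3
    have hΛeq : a • E = M / M := le_antisymm hΛle hOle
    refine ⟨(a * u₃) • L₁, isFullLattice_units_smul _ hL₁, ?_⟩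
    rw [mul_comm M ((a * u₃) • L₁), ← units_smul_mul, mul_comm L₁ M, hMΛ, hΛeq]
  · rintro ⟨L₂, hL₂, hML₂⟩
    refine ⟨M / M, L₂, 1, 1, 1, isFullLattice_div hM hM, hL₂, ?_, ?_, ?_⟩
    · rw [one_smul, div_self_mul_div_self_eq]
    · rw [one_smul, mul_comm, div_self_mul_self]
    · rw [one_smul, hML₂]

omit [∀ i, NumberField (L i)] [Fintype t] in
/-- **`𝒪(L⁻¹) = 𝒪(L)` for `L⁻¹ = 𝒪(L):L` when `L·(𝒪(L):L) = 𝒪(L)`** — in particular (iii) ⟹ (v) `𝒪(𝒪(L):L) = 𝒪(L)`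
(«(5.3) shows `𝒪(L)(𝒪(L):L) = 𝒪(L):L` … `L⁻¹ = 𝒪(L):L` and `𝒪(L⁻¹) = 𝒪(L)`»). [cite: HertlingLarabi2026, §5 Thm. 5.6 (c) (consequences; (i) ⟹ (v)), chunk p0012] -/
theorem div_div_self_of_mul_div_eq {M : Submodule ℤ (Π i, L i)} (h : M * ((M / M) / M) = M / M) :
    ((M / M) / M) / ((M / M) / M) = M / M := by
  refine le_antisymm (fun x hx => ?_) (Submodule.le_div_iff_mul_le.2 (Submodule.mul_le.2 fun a ha p hp => ?_))
  · -- `x𝒪(L) = x·L·(𝒪(L):L) ⊆ L·(𝒪(L):L) = 𝒪(L)`, so `x = x·1 ∈ 𝒪(L)`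
    rw [Submodule.mem_div_iff_forall_mul_mem] at hx
    have h1 : x * 1 ∈ M / M := by
      rw [← h, mul_comm M]
      have h1' : (1 : Π i, L i) ∈ ((M / M) / M) * M := by rw [mul_comm, h]; exact one_mem_div_self M
      refine Submodule.mul_induction_on h1' (fun p hp m hm => ?_) (fun y z hy hz => ?_)
      · rw [← mul_assoc]
        exact Submodule.mul_mem_mul (hx p hp) hm
      · rw [mul_add]
        exact Submodule.add_mem _ hy hz
    rwa [mul_one] at h1
  · -- `𝒪(L)·(𝒪(L):L) ⊆ 𝒪(L):L`
    rw [Submodule.mem_div_iff_forall_mul_mem] at hp ⊢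
    intro m hm
    rw [mul_assoc]
    exact (div_self_mul_div_self_eq M).le (Submodule.mul_mem_mul ha (hp m hm))

omit [∀ i, NumberField (L i)] [Fintype t] in
/-- **`L⁻¹ = 𝒪(L):L` is itself invertible, with `𝒪(L):L⁻¹ ⊇ L`: `L⁻¹·(𝒪(L):L⁻¹) = 𝒪(L)`** (so `[L⁻¹]` is the inverse
class and `(L⁻¹)⁻¹ ⊇ L`). [cite: HertlingLarabi2026, §5 Thm. 5.6 (c) («`L⁻¹` is invertible with `𝒪(L⁻¹) = 𝒪(L)`»), chunk p0012] -/
theorem inv_mul_div_eq_of_mul_div_eq {M : Submodule ℤ (Π i, L i)} (h : M * ((M / M) / M) = M / M) :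
    M ≤ (M / M) / ((M / M) / M) ∧ ((M / M) / M) * ((M / M) / ((M / M) / M)) = M / M := by
  have hle : M ≤ (M / M) / ((M / M) / M) := Submodule.le_div_iff_mul_le.2 h.le
  refine ⟨hle, le_antisymm ?_ ?_⟩
  · rw [mul_comm]
    exact Submodule.le_div_iff_mul_le.1 le_rfl
  · calc M / M = M * ((M / M) / M) := h.symm
      _ ≤ ((M / M) / ((M / M) / M)) * ((M / M) / M) := mul_le_mul_left hle _
      _ = ((M / M) / M) * ((M / M) / ((M / M) / M)) := mul_comm _ _

/-! ## §6 Lemma 5.3: orders `Λ_1Λ_2`, orders of products and quotients, the colon of an invertible lattice -/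

omit [∀ i, NumberField (L i)] [Fintype t] in
/-- **LEMMA 5.3 (a): for orders `Λ_1`, `Λ_2` the product `Λ_1Λ_2` is an order containing both, and the smallest such.**
[cite: HertlingLarabi2026, §5 Lemma 5.3 (a), chunk p0011] -/
theorem mul_isOrder_of_one_mem {Λ₁ Λ₂ : Submodule ℤ (Π i, L i)} (h₁ : (1 : Π i, L i) ∈ Λ₁) (hm₁ : Λ₁ * Λ₁ ≤ Λ₁)
    (h₂ : (1 : Π i, L i) ∈ Λ₂) (hm₂ : Λ₂ * Λ₂ ≤ Λ₂) :
    (1 : Π i, L i) ∈ Λ₁ * Λ₂ ∧ (Λ₁ * Λ₂) * (Λ₁ * Λ₂) ≤ Λ₁ * Λ₂ ∧ Λ₁ ≤ Λ₁ * Λ₂ ∧ Λ₂ ≤ Λ₁ * Λ₂ ∧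
      ∀ Λ : Submodule ℤ (Π i, L i), Λ * Λ ≤ Λ → Λ₁ ≤ Λ → Λ₂ ≤ Λ → Λ₁ * Λ₂ ≤ Λ := by
  refine ⟨?_, ?_, fun x hx => ?_, fun x hx => ?_, fun Λ hΛ hle₁ hle₂ => ?_⟩
  · rw [← one_mul (1 : Π i, L i)]
    exact Submodule.mul_mem_mul h₁ h₂
  · calc (Λ₁ * Λ₂) * (Λ₁ * Λ₂) = (Λ₁ * Λ₁) * (Λ₂ * Λ₂) := mul_mul_mul_comm _ _ _ _
      _ ≤ Λ₁ * Λ₂ := mul_le_mul' hm₁ hm₂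
  · rw [← mul_one x]
    exact Submodule.mul_mem_mul hx h₂
  · rw [← one_mul x]
    exact Submodule.mul_mem_mul h₁ hx
  · calc Λ₁ * Λ₂ ≤ Λ * Λ := mul_le_mul' hle₁ hle₂
      _ ≤ Λ := hΛ

omit [∀ i, NumberField (L i)] [Fintype t] in
/-- **LEMMA 5.3 (b), first inclusion: `𝒪(L_1)𝒪(L_2) ⊆ 𝒪(L_1L_2)`.** [cite: HertlingLarabi2026, §5 Lemma 5.3 (b) (5.3), chunk p0011] -/
theorem div_self_mul_div_self_le_div_self_mul (L₁ L₂ : Submodule ℤ (Π i, L i)) :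
    (L₁ / L₁) * (L₂ / L₂) ≤ (L₁ * L₂) / (L₁ * L₂) :=
  div_mul_div_le L₁ L₁ L₂ L₂

omit [∀ i, NumberField (L i)] [Fintype t] in
/-- **LEMMA 5.3 (b), second inclusion: `𝒪(L_1)𝒪(L_2) ⊆ 𝒪(L_1:L_2)`.** [cite: HertlingLarabi2026, §5 Lemma 5.3 (b) (5.3), chunk p0011] -/
theorem div_self_mul_div_self_le_div_self_div (L₁ L₂ : Submodule ℤ (Π i, L i)) :
    (L₁ / L₁) * (L₂ / L₂) ≤ (L₁ / L₂) / (L₁ / L₂) := by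
  refine Submodule.mul_le.2 fun a ha b hb => Submodule.mem_div_iff_forall_mul_mem.2 fun z hz =>
    Submodule.mem_div_iff_forall_mul_mem.2 fun y hy => ?_
  rw [Submodule.mem_div_iff_forall_mul_mem] at ha hb hz
  -- `(a b z) y = a (z (b y))` with `b y ∈ L_2`, `z(by) ∈ L_1`, `a(…) ∈ L_1`
  have h1 : a * b * z * y = a * (z * (b * y)) := by ring
  rw [h1]
  exact ha _ (hz _ (hb y hy))

omit [∀ i, NumberField (L i)] [Fintype t] in
/-- **LEMMA 5.3 (b): if `L_1` is invertible (`L_1·(𝒪(L_1):L_1) = 𝒪(L_1)`) then `L_1:L_2 = L_1·(𝒪(L_1):L_2)`.**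
[cite: HertlingLarabi2026, §5 Lemma 5.3 (b) (5.4), chunk p0011] -/
theorem div_eq_mul_div_of_mul_div_eq {L₁ : Submodule ℤ (Π i, L i)} (hL₁ : L₁ * ((L₁ / L₁) / L₁) = L₁ / L₁)
    (L₂ : Submodule ℤ (Π i, L i)) : L₁ / L₂ = L₁ * ((L₁ / L₁) / L₂) := by
  refine le_antisymm (fun x hx => ?_) (Submodule.mul_le.2 fun a ha c hc =>
    Submodule.mem_div_iff_forall_mul_mem.2 fun y hy => ?_)
  · -- `x = x·1`, `1 ∈ 𝒪(L_1) = L_1·L_1⁻¹`, and `x·L_1⁻¹ ⊆ 𝒪(L_1):L_2`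
    rw [Submodule.mem_div_iff_forall_mul_mem] at hx
    have hx' : ∀ p ∈ (L₁ / L₁) / L₁, x * p ∈ (L₁ / L₁) / L₂ := fun p hp =>
      Submodule.mem_div_iff_forall_mul_mem.2 fun y hy => by
        rw [Submodule.mem_div_iff_forall_mul_mem] at hp
        have e1 : x * p * y = p * (x * y) := by ring
        rw [e1]
        exact hp _ (hx y hy)
    have h1 : (1 : Π i, L i) ∈ L₁ * ((L₁ / L₁) / L₁) := by rw [hL₁]; exact one_mem_div_self L₁
    have key : ∀ w ∈ L₁ * ((L₁ / L₁) / L₁), x * w ∈ L₁ * ((L₁ / L₁) / L₂) := fun w hw =>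
      Submodule.mul_induction_on hw (fun l hl p hp => by
          rw [mul_left_comm]
          exact Submodule.mul_mem_mul hl (hx' p hp))
        (fun y z hy hz => by rw [mul_add]; exact Submodule.add_mem _ hy hz)
    simpa using key 1 h1
  · rw [Submodule.mem_div_iff_forall_mul_mem] at hc
    rw [mul_assoc, mul_comm a]
    have h2 := hc y hy
    rw [Submodule.mem_div_iff_forall_mul_mem] at h2
    exact h2 a ha

omit [∀ i, NumberField (L i)] [Fintype t] in
/-- **LEMMA 5.3 (b): if `L_2` is invertible (`L_2·(𝒪(L_2):L_2) = 𝒪(L_2)`) then `L_1:L_2 = (L_1:𝒪(L_2))·L_2⁻¹`**,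
`L_2⁻¹ = 𝒪(L_2):L_2`. [cite: HertlingLarabi2026, §5 Lemma 5.3 (b) (5.5), chunk p0011] -/
theorem div_eq_div_mul_of_mul_div_eq (L₁ : Submodule ℤ (Π i, L i)) {L₂ : Submodule ℤ (Π i, L i)}
    (hL₂ : L₂ * ((L₂ / L₂) / L₂) = L₂ / L₂) : L₁ / L₂ = (L₁ / (L₂ / L₂)) * ((L₂ / L₂) / L₂) := by
  refine le_antisymm (fun x hx => ?_) (Submodule.mul_le.2 fun a ha p hp =>
    Submodule.mem_div_iff_forall_mul_mem.2 fun y hy => ?_)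
  · -- `x = x·1`, `1 ∈ 𝒪(L_2) = L_2·L_2⁻¹`, and `x·L_2 ⊆ L_1:𝒪(L_2)`
    rw [Submodule.mem_div_iff_forall_mul_mem] at hx
    have hx' : ∀ l ∈ L₂, x * l ∈ L₁ / (L₂ / L₂) := fun l hl =>
      Submodule.mem_div_iff_forall_mul_mem.2 fun o ho => by
        rw [Submodule.mem_div_iff_forall_mul_mem] at ho
        rw [mul_assoc, mul_comm l]
        exact hx _ (ho l hl)
    have h1 : (1 : Π i, L i) ∈ L₂ * ((L₂ / L₂) / L₂) := by rw [hL₂]; exact one_mem_div_self L₂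
    have key : ∀ w ∈ L₂ * ((L₂ / L₂) / L₂), x * w ∈ (L₁ / (L₂ / L₂)) * ((L₂ / L₂) / L₂) := fun w hw =>
      Submodule.mul_induction_on hw (fun l hl p hp => by
          rw [← mul_assoc]
          exact Submodule.mul_mem_mul (hx' l hl) hp)
        (fun y z hy hz => by rw [mul_add]; exact Submodule.add_mem _ hy hz)
    simpa using key 1 h1
  · rw [Submodule.mem_div_iff_forall_mul_mem] at ha hp
    rw [mul_assoc]
    exact ha _ (hp y hy)

end Semigroup

end Literature.NumberTheory.ComplexMultiplication
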